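import Summits.SmoothPoincare4.SmoothPoincare4.Theses.VerlindeRLinks
import Literature.Topology.FourManifolds.FreeFundamentalGroupThreeManifoldHempel
import Literature.Topology.FourManifolds.DehnSurgeryProofs
import Literature.Topology.FourManifolds.DehnSurgeryCompactProofs
import Literature.Topology.FourManifolds.KirbyMovesProofs

/-!
# `VrlComponentsHBallSlice` — negative-side support (1): load-bearing hypotheses and tightness

Refuter lemmas (cdisprove seat, cycle 1, 2026-08-17) for crux item stmt-SmoothPoincare4-15874
(`VerlindeRLinks.VrlComponentsHBallSlice`: every component of an R-link — an `n`-component framed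
link `L ⊂ S³` whose integral surgery `Y` is `#ⁿ(S² × S¹)` — is slice in a homotopy `4`-ball,
`Knot.IsHomotopyBallSlice`).  The crux is a theorem on paper (Gompf–Scharlemann–Thompson 2010,
Prop. 2.3) and faithfully typed; no refutation exists.  This file records, sorry-free:

* §1 LOAD-BEARING ANALYSIS modulo the single missing input "some knot `K` is not slice in any
  homotopy ball" (true — the trefoil, Fox–Milnor / signature in homology balls — but no knot is
  certified non-slice in the tree), carried as the binders `(K : Knot) (hK : ¬ K.IsHomotopyBallSlice)`:
  - `withoutSurgery_iff`: with `L.IsSurgery (𝓡 3) Y` dropped the statement says exactly that every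
    knot is H-ball-slice (a closed `Y ≅ S² × S¹` exists: `exists_isSphereTwoProdCircleSum_closed`);
    hence `vrlComponentsHBallSlice_false_without_surgery_of`;
  - `forall_isHomotopyBallSlice_of_withoutSphereSum`: with `IsSphereTwoProdCircleSum n Y` dropped,
    `0`-surgery on `K` (`exists_isIntegralSurgery_holds`, link form, re-indexed `Unit ≃ Fin 1`)
    again forces every knot to be H-ball-slice; hence
    `vrlComponentsHBallSlice_false_without_sphereSum_of`;
  - `vrlComponentsHBallSlice_false_uncoupled_of`: with the component count uncoupled from the
    number of `S² × S¹` summands the statement fails at `(m, n) = (2, 0)` modulo the slam-dunk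
    fact "`(K, r) ∪ (meridian, 0)` is a surgery diagram of `S³`" (Gompf–Stipsicz Fig. 5.30),
    carried as a hypothesis.
* §2 TIGHTNESS: the natural strengthening "components of R-links are slice IN `B⁴`" follows from
  SPC4 and the crux (`strengtheningSliceInBall_of_spc4`, by the PROVED FGMW lemma) and is refuted
  by the route's other two cruxes (`not_strengtheningSliceInBall_of_slideGap_of_sliceRigidity`,
  pure logic) — the homotopy sphere in the conclusion cannot be upgraded to `S⁴` inside the route.

Work file with the prose analysis: `Cruxes/VrlComponentsHBallSlice/Disproof.lean`.
-/

-- the prescribed namespace `Summit.<P>.<Sub>.…` duplicates `SmoothPoincare4` (P = Sub)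
set_option linter.dupNamespace false

noncomputable section

namespace Summit.SmoothPoincare4.SmoothPoincare4.Theorems.VrlComponentsHBallSlice.Negative

open scoped Manifold ContDiff Topology
open Set Function
open Literature.Topology.FourManifolds
open Summit.SmoothPoincare4.SmoothPoincare4.Theses.VerlindeRLinks

/-! ## §1 Load-bearing hypotheses -/

/-- Under SPC4 the missing input "some knot is not H-ball-slice" is just the existence of a
non-slice knot (contrapositive of the FGMW lemma, proved in the tree as
`Knot.exists_exotic_of_isHomotopyBallSlice_not_isSmoothlySlice_holds`).
[cite: FreedmanGompfMorrisonWalker2010, §1] -/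
theorem exists_not_isHomotopyBallSlice_of_spc4 (hS : _root_.SmoothPoincare4)
    (h : ∃ K : Knot, ¬ K.IsSmoothlySlice) : ∃ K : Knot, ¬ K.IsHomotopyBallSlice := by
  obtain ⟨K, hK⟩ := h
  refine ⟨K, fun hH => ?_⟩
  obtain ⟨M, _, _, _, _, _, _, ⟨e⟩, hE⟩ :=
    Knot.exists_exotic_of_isHomotopyBallSlice_not_isSmoothlySlice_holds ⟨K, hH, hK⟩
  obtain ⟨d⟩ := hS M ‹_› ‹_› e
  exact hE.false d

/-- With the surgery hypothesis `L.IsSurgery (𝓡 3) Y` dropped, `L` is decoupled from `Y`, and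
since a closed `Y ≅ S² × S¹` exists in the tree (`exists_isSphereTwoProdCircleSum_closed 1`) the
weakened crux says exactly that EVERY knot is slice in a homotopy ball. [folklore] -/
theorem withoutSurgery_iff :
    (∀ (n : ℕ) (L : FramedLink (Fin n)) (Y : Type) [TopologicalSpace Y] [T2Space Y]
        [SecondCountableTopology Y] [ChartedSpace (EuclideanSpace ℝ (Fin 3)) Y]
        [IsManifold (𝓡 3) ∞ Y] [CompactSpace Y] [ConnectedSpace Y],
        IsSphereTwoProdCircleSum n Y → ∀ i : Fin n, (L.component i).IsHomotopyBallSlice) ↔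
      ∀ K : Knot, K.IsHomotopyBallSlice := by
  constructor
  · intro hW K
    obtain ⟨Y, _, _, _, _, _, _, _, -, hY⟩ := exists_isSphereTwoProdCircleSum_closed 1
    simpa using hW 1 (FramedLink.single K 0) Y hY 0
  · intro h n L Y _ _ _ _ _ _ _ _ i
    exact h _

/-- **LOAD-BEARING: `L.IsSurgery (𝓡 3) Y`.**  Given one knot `K` that is not slice in any homotopy
ball, the crux with the surgery hypothesis dropped is false: any proof must use that `Y` is the
surgery on `L`. [folklore] -/
theorem vrlComponentsHBallSlice_false_without_surgery_of (K : Knot)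
    (hK : ¬ K.IsHomotopyBallSlice) :
    ¬ ∀ (n : ℕ) (L : FramedLink (Fin n)) (Y : Type) [TopologicalSpace Y] [T2Space Y]
        [SecondCountableTopology Y] [ChartedSpace (EuclideanSpace ℝ (Fin 3)) Y]
        [IsManifold (𝓡 3) ∞ Y] [CompactSpace Y] [ConnectedSpace Y],
        IsSphereTwoProdCircleSum n Y → ∀ i : Fin n, (L.component i).IsHomotopyBallSlice :=
  fun hW => hK (withoutSurgery_iff.1 hW K)

/-- With the hypothesis `IsSphereTwoProdCircleSum n Y` dropped, every knot is again forced to be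
H-ball-slice: `0`-surgery on `K` exists as a closed smooth `3`-manifold
(`exists_isIntegralSurgery_holds`; connected by `IsIntegralSurgery.connectedSpace_holds`) and is a
surgery on the one-component framed link `(K, 0)` (`IsIntegralSurgery.isIntegralSurgeryLink_holds`,
re-indexed along `finOneEquiv : Fin 1 ≃ Unit` by `FramedLink.isSurgery_reindex_iff_holds`).
[folklore] -/
theorem forall_isHomotopyBallSlice_of_withoutSphereSum
    (hW : ∀ (n : ℕ) (L : FramedLink (Fin n)) (Y : Type) [TopologicalSpace Y] [T2Space Y]
        [SecondCountableTopology Y] [ChartedSpace (EuclideanSpace ℝ (Fin 3)) Y]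
        [IsManifold (𝓡 3) ∞ Y] [CompactSpace Y] [ConnectedSpace Y],
        L.IsSurgery (𝓡 3) Y → ∀ i : Fin n, (L.component i).IsHomotopyBallSlice) :
    ∀ K : Knot, K.IsHomotopyBallSlice := by
  intro K
  obtain ⟨Y, _, _, _, _, _, _, hY⟩ := exists_isIntegralSurgery_holds K 0
  haveI : ConnectedSpace Y := IsIntegralSurgery.connectedSpace_holds hY
  -- the one-component framed link `(K, 0)` indexed by `Unit`, the index type of `Link.ofKnot`
  let LU : FramedLink Unit := ⟨Link.ofKnot K, fun _ => 0⟩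
  have hU : LU.IsSurgery (𝓡 3) Y := IsIntegralSurgery.isIntegralSurgeryLink_holds hY
  have hL : (LU.reindex finOneEquiv).IsSurgery (𝓡 3) Y :=
    (FramedLink.isSurgery_reindex_iff_holds finOneEquiv LU).2 hU
  exact hW 1 (LU.reindex finOneEquiv) Y hL 0

/-- Hence the crux with `IsSphereTwoProdCircleSum n Y` dropped is again EQUIVALENT to "every knot
is H-ball-slice". [folklore] -/
theorem withoutSphereSum_iff :
    (∀ (n : ℕ) (L : FramedLink (Fin n)) (Y : Type) [TopologicalSpace Y] [T2Space Y]
        [SecondCountableTopology Y] [ChartedSpace (EuclideanSpace ℝ (Fin 3)) Y]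
        [IsManifold (𝓡 3) ∞ Y] [CompactSpace Y] [ConnectedSpace Y],
        L.IsSurgery (𝓡 3) Y → ∀ i : Fin n, (L.component i).IsHomotopyBallSlice) ↔
      ∀ K : Knot, K.IsHomotopyBallSlice :=
  ⟨forall_isHomotopyBallSlice_of_withoutSphereSum, fun h _ _ _ _ _ _ _ _ _ _ _ _ => h _⟩

/-- What either dropped hypothesis would buy under SPC4: EVERY knot smoothly slice in `B⁴` (FGMW
lemma, proved in the tree) — the vivid form of "both hypotheses are load-bearing".
[cite: FreedmanGompfMorrisonWalker2010, §1] -/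
theorem forall_isSmoothlySlice_of_forall_isHomotopyBallSlice_of_spc4
    (h : ∀ K : Knot, K.IsHomotopyBallSlice) (hS : _root_.SmoothPoincare4) :
    ∀ K : Knot, K.IsSmoothlySlice := by
  intro K
  by_contra hK
  obtain ⟨M, _, _, _, _, _, _, ⟨e⟩, hE⟩ :=
    Knot.exists_exotic_of_isHomotopyBallSlice_not_isSmoothlySlice_holds ⟨K, h K, hK⟩
  obtain ⟨d⟩ := hS M ‹_› ‹_› e
  exact hE.false d

/-- **LOAD-BEARING: `IsSphereTwoProdCircleSum n Y`.**  Given one knot that is not slice in any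
homotopy ball, the crux with "the surgery is `#ⁿ(S² × S¹)`" dropped is false: any proof must use
it. [folklore] -/
theorem vrlComponentsHBallSlice_false_without_sphereSum_of (K : Knot)
    (hK : ¬ K.IsHomotopyBallSlice) :
    ¬ ∀ (n : ℕ) (L : FramedLink (Fin n)) (Y : Type) [TopologicalSpace Y] [T2Space Y]
        [SecondCountableTopology Y] [ChartedSpace (EuclideanSpace ℝ (Fin 3)) Y]
        [IsManifold (𝓡 3) ∞ Y] [CompactSpace Y] [ConnectedSpace Y],
        L.IsSurgery (𝓡 3) Y → ∀ i : Fin n, (L.component i).IsHomotopyBallSlice :=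
  fun hW => hK (forall_isHomotopyBallSlice_of_withoutSphereSum hW K)

/-- **LOAD-BEARING: the coupling "`#components of L = #summands of Y`".**  Off the diagonal, at
`(m, n) = (2, 0)`, the uncoupled statement fails modulo the slam-dunk fact `hSD` ("for every knot
`K` and framing `r`, `(K, r) ∪ (0-framed meridian)` is a surgery diagram of `S³`",
Gompf–Stipsicz (1999), §5.1, Fig. 5.30 — stated as a hypothesis, not in the tree) and one knot
`K` not slice in any homotopy ball. [cite: GompfStipsicz1999, §5.1 Fig. 5.30] -/
theorem vrlComponentsHBallSlice_false_uncoupled_of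
    (hSD : ∀ (K : Knot) (r : ℤ), ∃ L : FramedLink (Fin 2), L.component 0 = K ∧
      L.IsSurgery (𝓡 3) (Metric.sphere (0 : EuclideanSpace ℝ (Fin 4)) 1))
    (K : Knot) (hK : ¬ K.IsHomotopyBallSlice) :
    ¬ ∀ (m n : ℕ) (L : FramedLink (Fin m)) (Y : Type) [TopologicalSpace Y] [T2Space Y]
        [SecondCountableTopology Y] [ChartedSpace (EuclideanSpace ℝ (Fin 3)) Y]
        [IsManifold (𝓡 3) ∞ Y] [CompactSpace Y] [ConnectedSpace Y],
        IsSphereTwoProdCircleSum n Y → L.IsSurgery (𝓡 3) Y →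
          ∀ i : Fin m, (L.component i).IsHomotopyBallSlice := by
  intro hU
  obtain ⟨L, hLK, hL⟩ := hSD K 0
  haveI : ConnectedSpace (Metric.sphere (0 : EuclideanSpace ℝ (Fin 4)) 1) := by
    refine isConnected_iff_connectedSpace.mp (isConnected_sphere ?_ 0 zero_le_one)
    rw [← Module.finrank_eq_rank, finrank_euclideanSpace_fin]
    norm_num
  have h0 : IsSphereTwoProdCircleSum 0 (Metric.sphere (0 : EuclideanSpace ℝ (Fin 4)) 1) :=
    (isSphereTwoProdCircleSum_zero_iff _).2 ⟨Diffeomorph.refl (𝓡 3) _ ∞⟩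
  have := hU 2 0 L _ h0 hL 0
  rw [hLK] at this
  exact hK this

/-! ## §2 Tightness: the strengthening "slice in `B⁴`" is SPC4-complete relative to the route -/

/-- SPC4 and the crux give the strengthening "every component of an R-link is smoothly slice in
`B⁴`" (FGMW lemma, proved in the tree). [cite: FreedmanGompfMorrisonWalker2010, §1] -/
theorem strengtheningSliceInBall_of_spc4 (hS : _root_.SmoothPoincare4)
    (hC : VrlComponentsHBallSlice) :
    ∀ (n : ℕ) (L : FramedLink (Fin n)) (Y : Type) [TopologicalSpace Y] [T2Space Y]
      [SecondCountableTopology Y] [ChartedSpace (EuclideanSpace ℝ (Fin 3)) Y]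
      [IsManifold (𝓡 3) ∞ Y] [CompactSpace Y] [ConnectedSpace Y],
      IsSphereTwoProdCircleSum n Y → L.IsSurgery (𝓡 3) Y →
        ∀ i : Fin n, (L.component i).IsSmoothlySlice := by
  intro n L Y _ _ _ _ _ _ _ hY hL i
  by_contra hi
  obtain ⟨M, _, _, _, _, _, _, ⟨e⟩, hE⟩ :=
    Knot.exists_exotic_of_isHomotopyBallSlice_not_isSmoothlySlice_holds
      ⟨L.component i, hC n L Y hY hL i, hi⟩
  obtain ⟨d⟩ := hS M ‹_› ‹_› e
  exact hE.false d

/-- **TIGHT: the strengthening "slice in `B⁴`" is refuted by the route's other two cruxes** (pure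
logic, as in `closes`): a slide gap plus slice rigidity produce an R-link component that is not
slice in `B⁴`.  So the homotopy sphere in the crux's conclusion cannot be upgraded to `S⁴` inside
this route. [folklore] -/
theorem not_strengtheningSliceInBall_of_slideGap_of_sliceRigidity (h₁ : VrlSlideGap)
    (h₂ : VrlSliceRigidity) :
    ¬ ∀ (n : ℕ) (L : FramedLink (Fin n)) (Y : Type) [TopologicalSpace Y] [T2Space Y]
        [SecondCountableTopology Y] [ChartedSpace (EuclideanSpace ℝ (Fin 3)) Y]
        [IsManifold (𝓡 3) ∞ Y] [CompactSpace Y] [ConnectedSpace Y],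
        IsSphereTwoProdCircleSum n Y → L.IsSurgery (𝓡 3) Y →
          ∀ i : Fin n, (L.component i).IsSmoothlySlice := by
  intro hS
  obtain ⟨iν, n, L, Y, i₁, i₂, i₃, i₄, i₅, i₆, i₇, hY, hL, hgap⟩ := h₁
  obtain ⟨U, hU, hLU⟩ :=
    @h₂ iν n L Y i₁ i₂ i₃ i₄ i₅ i₆ i₇ hY hL (@hS n L Y i₁ i₂ i₃ i₄ i₅ i₆ i₇ hY hL)
  exact hgap U hU hLU

end Summit.SmoothPoincare4.SmoothPoincare4.Theorems.VrlComponentsHBallSlice.Negative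

end
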